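import Literature.NumberTheory.EllipticCurves.HeegnerPointsKolyvaginPrimaryOrderHCTVProofs
import Summits.BirchSwinnertonDyer.BirchSwinnertonDyer.Theorems.ClassRecordThreeShimuraKolyvaginOrderBoundAtThreeSurjOrderCTValue
import Summits.BirchSwinnertonDyer.BirchSwinnertonDyer.Theorems.ClassRecordThreeShimuraKolyvaginOrderBoundAtThreeSurjDeepLevel
import HarnessLib

/-!
# Kolyvagin's ORDER bound, conductor-keyed, run at DEPTH `M + k` (Kolyvagin primes with `Frob(ℓ) = Frob(∞)` on
# `E[p^{2M₀+k}]`, classes at level `p^{2M₀}`) — part 1′: McCallum Prop. 4.7 and the value formula `hCTV`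

Cell `bsd-stepL` (run/shared/lean/pub/bsd-stepL/), seat `bsd-stepL-shim3a` (prover g2), HELPER for the crux
`Summit.BirchSwinnertonDyer.BirchSwinnertonDyer.Theses.ClassRecordThree.ShimuraKolyvaginOrderBoundAtThreeSurj`
(item stmt-BirchSwinnertonDyer-19899; `--supports … --as helper`); serves equally S2 `stub_inert_divisibleIndex`
of item 19718 and item 19627 (the `p ≥ 5` Shimura twins). Road memo HOME/shim/SHIM3A-G2-ROAD-19899.md §2 (ε₃).

## Why

x11b3's ORDER machine (`KolyvaginOrder.card_sha_primary_le_at_of_pointsM_of_reciprocityFinset_of_localDuality`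
over `KolyvaginDescent.card_sha_primaryComponent_le_of_localTerm`, McCallum 1991 §1 Theorem ∕ Thm. 5.4 ∕
Cor. 5.6) is abstract in the Euler-system points EXCEPT for the binder `hP : IsHeegnerPoint N₀ W K Pt`, which
is FALSE for the Heegner point of a genuine Shimura curve `X_{N⁺,N⁻}` (no Heegner point of level `N` on
`X₀(N)` over `K` when some `ℓ ∣ N` is inert) and which the machine uses ONLY for good reduction at the
Kolyvagin primes (`IsKolyvaginPrime.not_mem_badPlaces hP`; cell memos S1S2-ROAD-19718 §1, LOCAL-HALF-19718
§3). shim-p1 re-keyed the `m₀ = 0` entry on `hN : W.conductorNorm ℤ = N₀` (p470900 ∕ p471634); this file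
and its sequels do the same for the ORDER form, theorem by theorem, proofs copied token for token with the
single substitution `hKol.1.not_mem_badPlaces hP ↦ not_mem_badPlaces_of_conductorNorm W hN hKol.1`.

Step (iii), first file, of the ORDER-form level shift (road memo §2 (γ₃′)): the conductor-keyed part 1
(`…SurjOrderCTValue.lean`, p478168) with the Kolyvagin-prime predicate of every binder taken ONE LEVEL DEEPER,
`IsKolyvaginPrime N W K p q ∧ FrobEqFrobInfty W K (p ^ (2 * M₀ + k)) q` (classes stay in `H¹(K, E[p^{2M₀}])`);
the one place the proof consumes `Frob(ℓ) = Frob(∞)` at the classes' level (`Γ_{K_λ}` fixes `E[p^{2M₀}]`) is fed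
through `ShimuraKolyvaginLocalShift.frobEqFrobInfty_of_dvd` (p480963). Everything else token for token.

* `ctLevelPairing_pullback_ne_zero_iff_localTerm_kolyvaginClass_shift`, `hCTV_of_localTerm_shift`.

## Honest framing

THEOREMS ONLY (no `def`, no named fact, no `sorry`; axioms standard); statements = the tree's, with
`(hP : IsHeegnerPoint N₀ W K Pt)` replaced by `(hN : W.conductorNorm ℤ = N₀)`; proofs = the tree's
(x11b3-p2, b2b-bsdres) verbatim up to that substitution. Nothing here constructs an Euler system or
discharges a Cassels–Tate input; item 19899 stays OPEN. BSD is not proved by any of this.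

## References

[cite: McCallumLMS1991, §4 Lemma 4.3, Prop. 4.4, Prop. 4.7; §5 Lemma 5.3, Thm. 5.4 (proof)]
[cite: GrossLMS1991, §3 (3.1)–(3.2), Lemma 4.3] [cite: MilneADT2006, Ch. I §6, Prop. 6.9]
presearch: not applicable (re-keying of tree theorems). Tree: `lean search 'hCTV_of_localTerm_shift'` → none.
-/

noncomputable section

open scoped Classical AddSubgroup
set_option linter.dupNamespace false
namespace Summit.BirchSwinnertonDyer.BirchSwinnertonDyer.Theorems.ShimuraKolyvaginOrder

open CategoryTheory _root_.WeierstrassCurve Field Function NumberField IsDedekindDomain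
open Literature.NumberTheory.EllipticCurves Literature.NumberTheory.EllipticCurves.KolyvaginDescent
open Literature.NumberTheory.GaloisRepresentations Literature.NumberTheory.GaloisCohomology
open Literature.NumberTheory.GaloisRepresentations.DiscreteGaloisModule (mu MuCarrier pairing)
open Literature.GroupTheory.FiniteAbelian
open Summit.BirchSwinnertonDyer.BirchSwinnertonDyer.Theorems
open Summit.BirchSwinnertonDyer.BirchSwinnertonDyer.Theorems.ShimuraKolyvaginLocalShift (frobEqFrobInfty_of_dvd)
open scoped ContRepresentation

-- Cup products need `LocallyCompactSpace Γ`; as in the tree's cup-product files, the compactness of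
-- absolute Galois groups is a local instance only.
attribute [local instance] absoluteGaloisGroup_compactSpace

-- `char K_v = 0` for the completions of a number field (local instance, no override).
attribute [local instance] charZero_placeCompletion

variable (W : WeierstrassCurve ℚ) {K : Type} [Field K] [NumberField K]

omit [NumberField K] in
/-- A finite place containing (the image of) a square-free natural number contains one of its prime
factors (copy of the tree's private lemma of the same name). [folklore] -/
private theorem exists_mem_primeFactors_natCast_mem {m' : ℕ} (hm' : Squarefree m')
    {v : HeightOneSpectrum (𝓞 K)} (hv : (m' : 𝓞 K) ∈ v.asIdeal) :
    ∃ q ∈ m'.primeFactors, (q : 𝓞 K) ∈ v.asIdeal := by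
  rw [← Nat.prod_primeFactors_of_squarefree hm', Nat.cast_prod] at hv
  exact (Ideal.IsPrime.prod_mem_iff (hp := v.isPrime)).mp hv

section Value


variable [W.IsElliptic] {p M₀ : ℕ} [NeZero (p ^ M₀)]
variable (e : geomTorsion (W.baseChange K) ((p ^ M₀ * p ^ M₀ : ℕ) : ℤ) →
    geomTorsion (W.baseChange K) ((p ^ M₀ * p ^ M₀ : ℕ) : ℤ) → AlgebraicClosure K)
  (hμ : ∀ S T, e S T ^ (p ^ M₀ * p ^ M₀) = 1)
  (hadd₁ : ∀ S₁ S₂ T, e (S₁ + S₂) T = e S₁ T * e S₂ T)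
  (hadd₂ : ∀ S T₁ T₂, e S (T₁ + T₂) = e S T₁ * e S T₂)
  (hgal : ∀ (σ : absoluteGaloisGroup K) (S T : geomTorsion (W.baseChange K) ((p ^ M₀ * p ^ M₀ : ℕ) : ℤ)),
    σ • e S T = e (σ • S) (σ • T))
variable (inv : LocalInvariants K (p ^ M₀ * p ^ M₀))
-- `hPT'` is the reciprocity predicate `LocalInvariants.SumInvLocalizationEqZero` on `inv`, not a named fact.
variable (halt : ∀ T, e T T = 1) (hPT' : inv.SumInvLocalizationEqZero)
  (hH3 : ∀ c : galoisCohomology (mu K (p ^ M₀ * p ^ M₀)) 3,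
    (∀ v : Place K, galoisCohomology.localization (mu K (p ^ M₀ * p ^ M₀)) v 3 c = 0) → c = 0)
  (hfin : ∀ D : GeneralCaseData (W.baseChange K) (p ^ M₀) e hμ hadd₁ hadd₂ hgal,
    ∃ S : Finset (Place K), ∀ v ∉ S, D.localTerm inv v = 0)
variable (ι : selmerGroup (W.baseChange K) ((p ^ M₀ * p ^ M₀ : ℕ) : ℤ) →+ ((W.baseChange K).sha)[p ^ M₀])
  (hι : ∀ z, shaTorsionVal (W.baseChange K) (p ^ M₀) (ι z) =
    torsionH1ToH1 (W.baseChange K) ((p ^ M₀ * p ^ M₀ : ℕ) : ℤ) z)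

include halt hPT' hι in
/-- **The Cassels–Tate value on a Kolyvagin pair is the local term at `λ`, conductor-keyed, depth `2M₀ + k`** — twin of
`KolyvaginDescent.ctLevelPairing_pullback_ne_zero_iff_localTerm_kolyvaginClass` (McCallum 1991, Prop. 4.7 as
used in the proof of Thm. 5.4, for the descent data at level `M = 2M₀`, `m = p^{M₀}`) with
`hP : IsHeegnerPoint N W K P` replaced by `hN : W.conductorNorm ℤ = N` (its only use: `Γ_{K_v}` fixes
`E[p^{2M₀}]` at the Kolyvagin places of `m'`, which needs good reduction there). Statement otherwise VERBATIM;
proof = the tree's. [cite: McCallumLMS1991, §4 Lemma 4.3, Prop. 4.7; §5 Thm. 5.4 (proof)]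
[cite: GrossLMS1991, §3 (3.1)–(3.2)] -/
theorem ctLevelPairing_pullback_ne_zero_iff_localTerm_kolyvaginClass_shift
    (hK : IsImaginaryQuadratic K) {N : ℕ} [NeZero N] (hN : W.conductorNorm ℤ = N) (k : ℕ) (hp : p.Prime) (hp2 : p ≠ 2) (hρ : W.HasSurjectiveModNGaloisRep p)
    (cl : ℕ → galH1Torsion (W.baseChange K) ((p ^ M₀ * p ^ M₀ : ℕ) : ℤ))
    (hcl : ∀ n : ℕ, Squarefree n →
      (∀ q ∈ n.primeFactors, IsKolyvaginPrime N W K p q ∧ FrobEqFrobInfty W K (p ^ (2 * M₀ + k)) q) →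
      ∀ v : HeightOneSpectrum (𝓞 K), (n : 𝓞 K) ∉ v.asIdeal →
        cl n ∈ selmerLocalKer (W.baseChange K) (v.adicCompletion K) ((p ^ M₀ * p ^ M₀ : ℕ) : ℤ))
    {ℓ m' : ℕ} (hℓ : IsKolyvaginPrime N W K p ℓ ∧ FrobEqFrobInfty W K (p ^ (2 * M₀ + k)) ℓ)
    (hsupp : KolSupp (fun q => IsKolyvaginPrime N W K p q ∧ FrobEqFrobInfty W K (p ^ (2 * M₀ + k)) q)
      (ℓ * m'))
    {j N' : ℕ} (hj : M₀ ≤ j) (hN' : N' ≤ M₀)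
    {t : galH1Torsion (W.baseChange K) ((p ^ M₀ * p ^ M₀ : ℕ) : ℤ)}
    (ht : t ∈ selmerGroup (W.baseChange K) ((p ^ M₀ * p ^ M₀ : ℕ) : ℤ))
    (hz : ((p : ℤ) ^ j) • cl (ℓ * m') ∈ selmerGroup (W.baseChange K) ((p ^ M₀ * p ^ M₀ : ℕ) : ℤ))
    (hpt : ((p : ℤ) ^ N') • t = 0)
    (hAq : ∀ q ∈ m'.primeFactors, ∀ v : HeightOneSpectrum (𝓞 K), (q : 𝓞 K) ∈ v.asIdeal →
      t ∈ (W.baseChange K).torsionLocalKer (v.adicCompletion K) ((p ^ M₀ * p ^ M₀ : ℕ) : ℤ)) :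
    (∃ D : FirstCaseData (W.baseChange K) (p ^ M₀), D.b₁ = ((p : ℤ) ^ (j - M₀)) • cl (ℓ * m') ∧
      galoisCohomology.map (inclKD (W.baseChange K) (p ^ M₀) (p ^ M₀)) 1 D.b' = t) ∧
    ∀ D : FirstCaseData (W.baseChange K) (p ^ M₀), D.b₁ = ((p : ℤ) ^ (j - M₀)) • cl (ℓ * m') →
      galoisCohomology.map (inclKD (W.baseChange K) (p ^ M₀) (p ^ M₀)) 1 D.b' = t →
      (ctLevelPairing (W.baseChange K) (p ^ M₀) e hμ hadd₁ hadd₂ hgal inv halt hPT' hH3 hfin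
          (ι ⟨_, hz⟩) (ι ⟨t, ht⟩) ≠ 0 ↔
        D.localTerm e hμ hadd₁ hadd₂ hgal inv (Sum.inr hℓ.1.place) ≠ 0) := by
  have hk0 : p ^ M₀ * p ^ M₀ ≠ 0 := mul_ne_zero (NeZero.ne _) (NeZero.ne _)
  -- `z = p^{M₀} • (p^{j-M₀} • c(n))`
  have hz' : ((⟨_, hz⟩ : selmerGroup (W.baseChange K) ((p ^ M₀ * p ^ M₀ : ℕ) : ℤ)) :
      galH1Torsion (W.baseChange K) ((p ^ M₀ * p ^ M₀ : ℕ) : ℤ)) =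
        ((p ^ M₀ : ℕ) : ℤ) • ((p : ℤ) ^ (j - M₀)) • cl (ℓ * m') := by
    have h1 : ((p ^ M₀ : ℕ) : ℤ) * (p : ℤ) ^ (j - M₀) = (p : ℤ) ^ j := by
      rw [Nat.cast_pow, ← pow_add, Nat.add_sub_cancel' hj]
    change ((p : ℤ) ^ j) • cl (ℓ * m') = _
    rw [← mul_smul, h1]
  -- `p^{M₀} • t = 0`
  have hmt : ((p ^ M₀ : ℕ) : ℤ) • ((⟨t, ht⟩ : selmerGroup (W.baseChange K) ((p ^ M₀ * p ^ M₀ : ℕ) : ℤ)) :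
      galH1Torsion (W.baseChange K) ((p ^ M₀ * p ^ M₀ : ℕ) : ℤ)) = 0 := by
    have h2 : ((p ^ M₀ : ℕ) : ℤ) = (p : ℤ) ^ (M₀ - N') * (p : ℤ) ^ N' := by
      rw [Nat.cast_pow, ← pow_add, Nat.sub_add_cancel hN']
    change ((p ^ M₀ : ℕ) : ℤ) • t = 0
    rw [h2, mul_smul, hpt, zsmul_zero]
  -- `E[p^{M₀}]` has no non-zero `Γ_K`-fixed point
  have hfix : ∀ Q : geomTorsion (W.baseChange K) ((p ^ M₀ : ℕ) : ℤ),
      (∀ σ : absoluteGaloisGroup K, σ • Q = Q) → Q = 0 :=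
    fun Q hQ => forall_smul_eq_imp_eq_zero_of_surjective W hK hp hp2 hρ M₀ Q hQ
  refine ⟨exists_firstCaseData_kolyvagin (W := W.baseChange K) (m := p ^ M₀) ⟨_, hz⟩ ⟨t, ht⟩
      (cl (ℓ * m')) ((p : ℤ) ^ (j - M₀)) hz' hfix hmt, fun D hD₁ hDt => ?_⟩
  -- the places `T` over the primes of `m'`
  have hm'sq : Squarefree m' := hsupp.1.squarefree_of_dvd (dvd_mul_left m' ℓ)
  refine ctLevelPairing_pullback_ne_zero_iff_localTerm_kolyvagin e hμ hadd₁ hadd₂ hgal inv halt hPT'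
    hH3 hfin ι hι _ _ (cl (ℓ * m')) ((p : ℤ) ^ (j - M₀)) hz' hℓ.1.place
    {v | ∃ q ∈ m'.primeFactors, (q : 𝓞 K) ∈ v.asIdeal} ?_ ?_ ?_ D hD₁ hDt
  · -- `c(n)` is Selmer off `λ` and the places of `m'` (Lemma 4.3; the complex place)
    intro v hv0 hvT
    rcases v with w | v
    · haveI : IsAlgClosed w.Completion :=
        isAlgClosed_of_ringEquiv (InfinitePlace.Completion.ringEquivComplexOfIsComplex
          (hK.2.isComplex w)).symm
      rw [selmerLocalKer_completion_inl, WeierstrassCurve.selmerLocalKer_eq_top_of_isAlgClosed]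
      trivial
    · rw [selmerLocalKer_completion_inr]
      refine hcl (ℓ * m') hsupp.1 hsupp.2 v ?_
      intro hmem
      obtain h | h := natCast_mul_mem_asIdeal hmem
      · exact hv0 (by rw [hℓ.1.mem_iff.mp h])
      · obtain ⟨q, hq, hqv⟩ := exists_mem_primeFactors_natCast_mem hm'sq h
        exact hvT v ⟨q, hq, hqv⟩ rfl
  · -- `t_v = 0` at the places over the primes of `m'`
    rintro v ⟨q, hq, hqv⟩
    haveI : CharZero (v.adicCompletion K) :=
      charZero_of_injective_algebraMap (algebraMap K (v.adicCompletion K)).injective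
    exact (mem_torsionLocalKer_iff_res_eq_zero (W.baseChange K) (v.adicCompletion K) hk0 t).mp
      (hAq q hq v hqv)
  · -- `Γ_{K_v}` fixes `E[p^{2M₀}]` at the (Kolyvagin) places of `m'`
    rintro v ⟨q, hq, hqv⟩ g Q
    have hqn : q ∈ (ℓ * m').primeFactors :=
      Nat.primeFactors_mono (dvd_mul_left m' ℓ) hsupp.1.ne_zero hq
    have hKol := hsupp.2 q hqn
    have hv : v = hKol.1.place := hKol.1.mem_iff.mp hqv
    subst hv
    haveI : NeZero (p ^ M₀ * p ^ M₀) := ⟨hk0⟩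
    have hpv : ((p : ℕ) : 𝓞 K) ∉ hKol.1.place.asIdeal :=
      not_natCast_mem_of_prime_ne hKol.1.prime hp hKol.1.2.2.2.1 hKol.1.place hKol.1.mem_place
    have hqlam : ((((p ^ M₀ * p ^ M₀ : ℕ) : ℤ)) : 𝓞 K) ∉ hKol.1.place.asIdeal := by
      have h3 : ((((p ^ M₀ * p ^ M₀ : ℕ) : ℤ)) : 𝓞 K) = ((p : ℕ) : 𝓞 K) ^ (M₀ + M₀) := by
        push_cast
        ring
      rw [h3]
      exact fun h => hpv (hKol.1.place.isPrime.mem_of_pow_mem _ h)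
    have hdk : p ^ M₀ * p ^ M₀ ∣ p ^ (2 * M₀ + k) := by
      rw [← pow_add, ← two_mul]; exact pow_dvd_pow p (Nat.le_add_right _ _)
    exact absGaloisRestrict_smul_geomTorsion_eq_of_kolyvaginPrime W hK hKol.1
      (ShimuraKolyvaginLocalShift.frobEqFrobInfty_of_dvd W K hdk hKol.2)
      (not_mem_badPlaces_of_conductorNorm W hN hKol.1) hqlam g Q


include halt hPT' hι in
/-- **`hCTV` from the local term at `λ`, conductor-keyed, depth `2M₀ + k`** — twin of
`KolyvaginDescent.HypothesesM.hCTV_of_localTerm` with `hP : IsHeegnerPoint N₀ W K Pt` replaced by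
`hN : W.conductorNorm ℤ = N₀`; statement otherwise VERBATIM (descent data `S` with its dictionary, leaf (A)'s
Selmer clause `hcl`, McCallum's Lemma 5.3 at `λ` as `hloc`), proof = the tree's with
`ctLevelPairing_pullback_ne_zero_iff_localTerm_kolyvaginClass_of_conductorNorm`.
[cite: McCallumLMS1991, §4 Prop. 4.7, §5 Lemma 5.3, Thm. 5.4 (proof)] [cite: MilneADT2006, Ch. I §6, Prop. 6.9] -/
theorem hCTV_of_localTerm_shift
    (hK : IsImaginaryQuadratic K) {N₀ : ℕ} [NeZero N₀] (hN : W.conductorNorm ℤ = N₀) (k : ℕ) (hp : p.Prime) (hp2 : p ≠ 2) (hρ : W.HasSurjectiveModNGaloisRep p)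
    (c : K ≃ₐ[ℚ] K) (ε : ℤ) (cl : ℕ → galH1Torsion (W.baseChange K) ((p ^ M₀ * p ^ M₀ : ℕ) : ℤ))
    (hcl : ∀ n : ℕ, Squarefree n →
      (∀ q ∈ n.primeFactors, IsKolyvaginPrime N₀ W K p q ∧ FrobEqFrobInfty W K (p ^ (2 * M₀ + k)) q) →
      ∀ v : HeightOneSpectrum (𝓞 K), (n : 𝓞 K) ∉ v.asIdeal →
        cl n ∈ selmerLocalKer (W.baseChange K) (v.adicCompletion K) ((p ^ M₀ * p ^ M₀ : ℕ) : ℤ))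
    (S : HypothesesM (galH1Torsion (W.baseChange K) ((p ^ M₀ * p ^ M₀ : ℕ) : ℤ))
      (HeightOneSpectrum (𝓞 K) ⊕ InfinitePlace K))
    (hSel : S.Sel = selmerGroup (W.baseChange K) ((p ^ M₀ * p ^ M₀ : ℕ) : ℤ)) (hSp : S.p = p)
    (hSM₀ : S.M₀ = M₀) (hSM : S.M = 2 * M₀)
    (hSτ : ∀ g, S.τ g = conjAct W c ((p ^ M₀ * p ^ M₀ : ℕ) : ℤ) g)
    (hSKol : ∀ ℓ, S.Kol ℓ ↔ IsKolyvaginPrime N₀ W K p ℓ ∧ FrobEqFrobInfty W K (p ^ (2 * M₀ + k)) ℓ)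
    (hSA : ∀ ℓ g, g ∈ S.A ℓ ↔ ∀ v : HeightOneSpectrum (𝓞 K), (ℓ : 𝓞 K) ∈ v.asIdeal →
      g ∈ (W.baseChange K).torsionLocalKer (v.adicCompletion K) ((p ^ M₀ * p ^ M₀ : ℕ) : ℤ))
    (hSc : ∀ n, S.c n = cl n) (hSε : S.ε = ε)
    (hloc : ∀ ℓ m : ℕ,
      (hℓ : IsKolyvaginPrime N₀ W K p ℓ ∧ FrobEqFrobInfty W K (p ^ (2 * M₀ + k)) ℓ) →
      KolSupp (fun q => IsKolyvaginPrime N₀ W K p q ∧ FrobEqFrobInfty W K (p ^ (2 * M₀ + k)) q) (ℓ * m) →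
      ¬ ℓ ∣ m →
      ∀ (j N a b : ℕ) (t : galH1Torsion (W.baseChange K) ((p ^ M₀ * p ^ M₀ : ℕ) : ℤ)),
      t ∈ selmerGroup (W.baseChange K) ((p ^ M₀ * p ^ M₀ : ℕ) : ℤ) →
      ((p : ℤ) ^ j) • cl (ℓ * m) ∈ selmerGroup (W.baseChange K) ((p ^ M₀ * p ^ M₀ : ℕ) : ℤ) →
      ((p : ℤ) ^ N) • t = 0 →
      conjAct W c ((p ^ M₀ * p ^ M₀ : ℕ) : ℤ) t = (ε * (-1) ^ (ℓ * m).primeFactors.card) • t →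
      (∀ q ∈ m.primeFactors, ∀ v : HeightOneSpectrum (𝓞 K), (q : 𝓞 K) ∈ v.asIdeal →
        t ∈ (W.baseChange K).torsionLocalKer (v.adicCompletion K) ((p ^ M₀ * p ^ M₀ : ℕ) : ℤ)) →
      M₀ ≤ j → N ≤ M₀ → N ≤ j → a + b + 1 = N →
      (¬ ∀ v : HeightOneSpectrum (𝓞 K), (ℓ : 𝓞 K) ∈ v.asIdeal →
        ((p : ℤ) ^ (a + (j - N))) • cl m ∈
          (W.baseChange K).torsionLocalKer (v.adicCompletion K) ((p ^ M₀ * p ^ M₀ : ℕ) : ℤ)) →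
      (¬ ∀ v : HeightOneSpectrum (𝓞 K), (ℓ : 𝓞 K) ∈ v.asIdeal →
        ((p : ℤ) ^ b) • t ∈ (W.baseChange K).torsionLocalKer (v.adicCompletion K) ((p ^ M₀ * p ^ M₀ : ℕ) : ℤ)) →
      ∀ D : FirstCaseData (W.baseChange K) (p ^ M₀), D.b₁ = ((p : ℤ) ^ (j - M₀)) • cl (ℓ * m) →
        galoisCohomology.map (inclKD (W.baseChange K) (p ^ M₀) (p ^ M₀)) 1 D.b' = t →
        D.localTerm e hμ hadd₁ hadd₂ hgal inv (Sum.inr hℓ.1.place) ≠ 0) :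
    ∀ ℓ m : ℕ, S.Kol ℓ → KolSupp S.Kol (ℓ * m) → ¬ ℓ ∣ m →
      ∀ (j N a b : ℕ) (t : galH1Torsion (W.baseChange K) ((p ^ M₀ * p ^ M₀ : ℕ) : ℤ))
        (ht : t ∈ S.Sel) (hz : ((S.p : ℤ) ^ j) • S.c (ℓ * m) ∈ S.Sel),
      ((S.p : ℤ) ^ N) • t = 0 → S.τ t = (S.ε * (-1) ^ (ℓ * m).primeFactors.card) • t →
      (∀ q ∈ m.primeFactors, t ∈ S.A q) → S.M - S.M₀ ≤ j → N + S.M₀ ≤ S.M → N ≤ j → a + b + 1 = N →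
      ((S.p : ℤ) ^ (a + (j - N))) • S.c m ∉ S.A ℓ → ((S.p : ℤ) ^ b) • t ∉ S.A ℓ →
      (((ctLevelPairing (W.baseChange K) (p ^ M₀) e hμ hadd₁ hadd₂ hgal inv halt hPT' hH3 hfin).comp
          (ι.comp (AddSubgroup.inclusion hSel.le))).compl₂ (ι.comp (AddSubgroup.inclusion hSel.le)))
        ⟨_, hz⟩ ⟨t, ht⟩ ≠ 0 := by
  intro ℓ m hKolℓ hsupp hℓm j N a b t ht hz hpt hτt hAq hMj hNM hNj hab hordc hordt
  -- translate through the dictionary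
  have hℓ : IsKolyvaginPrime N₀ W K p ℓ ∧ FrobEqFrobInfty W K (p ^ (2 * M₀ + k)) ℓ := (hSKol ℓ).mp hKolℓ
  have hsupp' : KolSupp (fun q => IsKolyvaginPrime N₀ W K p q ∧ FrobEqFrobInfty W K (p ^ (2 * M₀ + k)) q)
      (ℓ * m) := ⟨hsupp.1, fun q hq => (hSKol q).mp (hsupp.2 q hq)⟩
  have ht' : t ∈ selmerGroup (W.baseChange K) ((p ^ M₀ * p ^ M₀ : ℕ) : ℤ) := hSel ▸ ht
  have hz' : ((p : ℤ) ^ j) • cl (ℓ * m) ∈ selmerGroup (W.baseChange K) ((p ^ M₀ * p ^ M₀ : ℕ) : ℤ) := by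
    have h := hz
    rw [hSp, hSc, hSel] at h
    exact h
  have hpt' : ((p : ℤ) ^ N) • t = 0 := by
    have h := hpt
    rw [hSp] at h
    exact h
  have hτt' : conjAct W c ((p ^ M₀ * p ^ M₀ : ℕ) : ℤ) t = (ε * (-1) ^ (ℓ * m).primeFactors.card) • t := by
    rw [← hSτ, ← hSε]; exact hτt
  have hAq' : ∀ q ∈ m.primeFactors, ∀ v : HeightOneSpectrum (𝓞 K), (q : 𝓞 K) ∈ v.asIdeal →
      t ∈ (W.baseChange K).torsionLocalKer (v.adicCompletion K) ((p ^ M₀ * p ^ M₀ : ℕ) : ℤ) :=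
    fun q hq => (hSA q t).mp (hAq q hq)
  have hMj' : M₀ ≤ j := by rw [hSM, hSM₀] at hMj; omega
  have hNM' : N ≤ M₀ := by rw [hSM, hSM₀] at hNM; omega
  have hordc' : ¬ ∀ v : HeightOneSpectrum (𝓞 K), (ℓ : 𝓞 K) ∈ v.asIdeal →
      ((p : ℤ) ^ (a + (j - N))) • cl m ∈
        (W.baseChange K).torsionLocalKer (v.adicCompletion K) ((p ^ M₀ * p ^ M₀ : ℕ) : ℤ) := by
    intro h
    apply hordc
    rw [hSp, hSc]
    exact (hSA ℓ _).mpr h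
  have hordt' : ¬ ∀ v : HeightOneSpectrum (𝓞 K), (ℓ : 𝓞 K) ∈ v.asIdeal →
      ((p : ℤ) ^ b) • t ∈ (W.baseChange K).torsionLocalKer (v.adicCompletion K) ((p ^ M₀ * p ^ M₀ : ℕ) : ℤ) := by
    intro h
    apply hordt
    rw [hSp]
    exact (hSA ℓ _).mpr h
  -- McCallum Prop. 4.7: the value is the local term at `λ`
  obtain ⟨⟨D, hD₁, hDt⟩, hiff⟩ :=
    ctLevelPairing_pullback_ne_zero_iff_localTerm_kolyvaginClass_shift W e hμ hadd₁ hadd₂ hgal inv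
      halt hPT' hH3 hfin ι hι hK hN k hp hp2 hρ cl hcl hℓ hsupp' hMj' hNM' ht' hz' hpt' hAq'
  have hne := (hiff D hD₁ hDt).mpr (hloc ℓ m hℓ hsupp' hℓm j N a b t ht' hz' hpt' hτt' hAq' hMj'
    hNM' hNj hab hordc' hordt' D hD₁ hDt)
  -- unfold `P = B(ι ∘ incl ·, ι ∘ incl ·)`
  have e1 : AddSubgroup.inclusion hSel.le ⟨_, hz⟩ = ⟨_, hz'⟩ :=
    Subtype.ext (show ((S.p : ℤ) ^ j) • S.c (ℓ * m) = ((p : ℤ) ^ j) • cl (ℓ * m) by rw [hSp, hSc])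
  have e2 : AddSubgroup.inclusion hSel.le ⟨t, ht⟩ = ⟨t, ht'⟩ := Subtype.ext rfl
  change ctLevelPairing (W.baseChange K) (p ^ M₀) e hμ hadd₁ hadd₂ hgal inv halt hPT' hH3 hfin
      (ι (AddSubgroup.inclusion hSel.le ⟨_, hz⟩)) (ι (AddSubgroup.inclusion hSel.le ⟨t, ht⟩)) ≠ 0
  rw [e1, e2]
  exact hne

end Value

end Summit.BirchSwinnertonDyer.BirchSwinnertonDyer.Theorems.ShimuraKolyvaginOrder
end
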